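import Literature.AlgebraicGeometry.Resolution.DiffOpOver
import Literature.AlgebraicGeometry.Resolution.DiffOpCoordinateSpan
import Mathlib.RingTheory.Derivation.Basic
import Mathlib.RingTheory.Ideal.Quotient.Operations
import HarnessLib

/-!
# Differential operators INTO an algebra in the presence of a Hasse–Schmidt coordinate system (EGA IV₄ 16.11.2 over a
# map), and lifting of operators along a quotient map

Topic: `Literature/AlgebraicGeometry/Resolution`. Module-target companion of `DiffOpCoordinateSpan.lean` (operators
`B → B`) for the operators `T : A → M` into an `A`-algebra `M` of `DiffOpOver.lean` (`IsDiffOpOver k n T`,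
EGA IV₄ 16.8: operators between two modules, commutator criterion). Let `x = (x_i)_{i∈ι}` be a finite family in `A`
with

* (UNR-M) every `k`-derivation `A → M` killing the `x_i` vanishes (e.g. `A` formally unramified over `k[x]`), and
* (HS) a truncated Hasse–Schmidt system `Δ_q : A → A`, `|q| ≤ n`, along `x` (`Δ_0 = id`, higher Leibniz rule,
  `Δ_β(x^β) = 1`, `Δ_q(x^β) = 0` for `q ≰ β`) — as produced by `HasseSystemOfFormallySmooth.lean` on formally smooth
  coordinates.

Then:
* `isDiffOpOver_zero_of_commOver_coord_eq_zero`, `eq_zero_of_isDiffOpOver_of_apply_coordMonomial_eq_zero` —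
  uniqueness: an operator `A → M` of order `≤ m` killing the monomials `x^β`, `|β| ≤ m`, is zero;
* `mem_span_hasseSystem_of_isDiffOpOver` — **every `T : A → M` of order `≤ n` is `t ↦ Σ_{|q|≤n} Δ_q(t) · m_q`**,
  i.e. lies in the `M`-span of the `ι_M ∘ Δ_q` (EGA IV₄ 16.11.2 for `Hom_A(P^n_{A/k}, M)`: `P^n` is free on the `dx^q`);
* `exists_isDiffOpLE_comp_eq_of_isDiffOpOver` — **LIFTING along a quotient**: for an ideal `𝒩 ⊆ A`, every operator
  `T : A → A ⧸ 𝒩` over the quotient map of order `≤ n` is `mk ∘ D` for a differential operator `D : A → A` of order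
  `≤ n` (lift the coefficients `m_q`).

Consumer: `Hironaka2017/Lib/NaturalExtLeHighModel.lean` (campaign res-hironaka, Q-03-006: the natural extension `J^♮`
lies in the Taylor ideal — the coefficient functionals of the Taylor expansion lift to honest operators). Nothing of
that manuscript is asserted here.

## References
* [EGAIV4] A. Grothendieck, J. Dieudonné, ÉGA IV₄ — Déf. 16.8.1, Prop. 16.8.8 (operators between modules, commutator
  recursion), Thm. 16.11.2 / Cor. 16.11.3 (P^n free on the dz^q over étale coordinates; operators determined by
  their values on the z^q).
-/

open scoped BigOperators

namespace Literature.AlgebraicGeometry.Resolution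

section OverSpan

variable (k : Type*) {A M : Type*} [CommRing k] [CommRing A] [CommRing M] [Algebra k A] [Algebra k M]
  [Algebra A M] [IsScalarTower k A M]
variable {ι : Type*}

/-! ### Order zero -/

omit [IsScalarTower k A M] in
/-- An operator `A → M` of order `≤ 0` is `t ↦ t · T(1)`. [cite: EGAIV4, Prop. 16.8.8 (order ≤ 0 = A-linear)] -/
theorem IsDiffOpOver.apply_eq_mul_apply_one {T : A →ₗ[k] M} (hT : IsDiffOpOver k 0 T) (t : A) :
    T t = algebraMap A M t * T 1 := by
  have h := LinearMap.congr_fun (hT t) 1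
  rw [commOver_apply, mul_one, LinearMap.zero_apply, sub_eq_zero] at h
  exact h

/-- **Operators commuting with the coordinates have order `≤ 0`** (module-target form of
`isDiffOpLE_zero_of_commMul_coord_eq_zero`): under (UNR-M), an operator `T : A → M` of finite order with
`[T, x_i] = 0` for all `i` has order `≤ 0`. [cite: EGAIV4, Cor. 16.11.3 with Prop. 16.8.8 (b) (operators are determined along unramified coordinates)] -/
theorem isDiffOpOver_zero_of_commOver_coord_eq_zero {x : ι → A}
    (hunr : ∀ δ : Derivation k A M, (∀ i, δ (x i) = 0) → δ = 0) :
    ∀ {n : ℕ} {T : A →ₗ[k] M}, IsDiffOpOver k n T → (∀ i, commOver k T (x i) = 0) → IsDiffOpOver k 0 T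
  | 0, _, hT, _ => hT
  | n + 1, T, hT, hx => by
    -- every commutator `[T, a]` has order `≤ n` and commutes with the `x i`, hence has order `≤ 0`
    have hE : ∀ a : A, IsDiffOpOver k 0 (commOver k T a) := fun a =>
      isDiffOpOver_zero_of_commOver_coord_eq_zero hunr (hT a) fun i => by
        rw [commOver_comm, hx i, commOver_zero_left]
    have hEa : ∀ a t : A, commOver k T a t = algebraMap A M t * commOver k T a 1 := fun a t =>
      (hE a).apply_eq_mul_apply_one k t
    -- `a ↦ [T, a] 1 = T a − a·T 1` is a `k`-derivation `A → M` killing the `x i`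
    let δ : Derivation k A M :=
      { toFun := fun a => T a - algebraMap A M a * T 1
        map_add' := fun a a' => by simp only [map_add, add_mul]; ring
        map_smul' := fun r a => by
          rw [LinearMap.map_smul, RingHom.id_apply]
          simp only [Algebra.smul_def, RingHom.map_mul, ← IsScalarTower.algebraMap_apply k A M]
          ring
        map_one_eq_zero' := by simp
        leibniz' := fun a a' => by
          have h := hEa a a'
          simp only [commOver_apply, mul_one] at h
          change T (a * a') - algebraMap A M (a * a') * T 1 =
            a • (T a' - algebraMap A M a' * T 1) + a' • (T a - algebraMap A M a * T 1)
          rw [Algebra.smul_def, Algebra.smul_def, RingHom.map_mul, sub_eq_iff_eq_add'.mp h]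
          ring }
    have hδ : δ = 0 := hunr δ fun i => by
      have h := LinearMap.congr_fun (hx i) 1
      rw [commOver_apply, mul_one, LinearMap.zero_apply] at h
      exact h
    intro a
    ext t
    rw [hEa a t, LinearMap.zero_apply]
    have ha : commOver k T a 1 = 0 := by
      have := congrArg (fun δ : Derivation k A M => δ a) hδ
      simpa [δ, commOver_apply] using this
    rw [ha, mul_zero]

/-- **Uniqueness on low monomials** (module-target form of `eq_zero_of_isDiffOpLE_of_apply_coordMonomial_eq_zero`):
under (UNR-M), an operator `T : A → M` of order `≤ m` killing every monomial `x^β`, `|β| ≤ m`, is zero.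
[cite: EGAIV4, Thm. 16.11.2 (an operator of order ≤ m is determined by its values on the z^q, |q| ≤ m)] -/
theorem eq_zero_of_isDiffOpOver_of_apply_coordMonomial_eq_zero [Fintype ι] [DecidableEq ι] {x : ι → A}
    (hunr : ∀ δ : Derivation k A M, (∀ i, δ (x i) = 0) → δ = 0) :
    ∀ (m : ℕ) {T : A →ₗ[k] M}, IsDiffOpOver k m T →
      (∀ β : ι →₀ ℕ, β.degree ≤ m → T (∏ i, x i ^ β i) = 0) → T = 0
  | 0, T, hT, h0 => by
    have h1 : T 1 = 0 := by simpa using h0 0 (by simp)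
    ext t
    rw [hT.apply_eq_mul_apply_one k t, h1, mul_zero, LinearMap.zero_apply]
  | m + 1, T, hT, h0 => by
    have hcomm : ∀ i, commOver k T (x i) = 0 := fun i =>
      eq_zero_of_isDiffOpOver_of_apply_coordMonomial_eq_zero hunr m (hT (x i)) fun β hβ => by
        have hdeg : (Finsupp.single i 1 + β).degree ≤ m + 1 := by
          rw [map_add, Finsupp.degree_single]; omega
        rw [commOver_apply, coord_mul_prod_pow, h0 _ hdeg, h0 β (by omega), mul_zero, sub_zero]
    have hT0 : IsDiffOpOver k 0 T := isDiffOpOver_zero_of_commOver_coord_eq_zero k hunr hT hcomm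
    have h1 : T 1 = 0 := by simpa using h0 0 (by simp)
    ext t
    rw [hT0.apply_eq_mul_apply_one k t, h1, mul_zero, LinearMap.zero_apply]

/-! ### The span of a Hasse–Schmidt system, module-valued operators -/

omit [IsScalarTower k A M] in
/-- Negatives. [cite: EGAIV4, Déf. 16.8.1 with Prop. 16.8.8 (b) (operators A → M form an M-module)] -/
theorem IsDiffOpOver.neg {n : ℕ} {T : A →ₗ[k] M} (h : IsDiffOpOver k n T) : IsDiffOpOver k n (-T) := by
  have : -T = (-1 : M) • T := by ext t; simp
  rw [this]
  exact h.smul (-1)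

omit [IsScalarTower k A M] in
/-- Differences. [cite: EGAIV4, Déf. 16.8.1 with Prop. 16.8.8 (b) (operators A → M form an M-module)] -/
theorem IsDiffOpOver.sub {n : ℕ} {T T' : A →ₗ[k] M} (h : IsDiffOpOver k n T) (h' : IsDiffOpOver k n T') :
    IsDiffOpOver k n (T - T') := by
  rw [sub_eq_add_neg]
  exact h.add h'.neg

omit [IsScalarTower k A M] in
/-- Finite sums. [cite: EGAIV4, Déf. 16.8.1 with Prop. 16.8.8 (b) (operators A → M form an M-module)] -/
theorem IsDiffOpOver.sum {κ : Type*} {n : ℕ} (s : Finset κ) {T : κ → A →ₗ[k] M}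
    (h : ∀ i ∈ s, IsDiffOpOver k n (T i)) : IsDiffOpOver k n (∑ i ∈ s, T i) := by
  classical
  induction s using Finset.induction_on with
  | empty => simpa using IsDiffOpOver.zero n
  | insert i s hi ih =>
    rw [Finset.sum_insert hi]
    exact (h i (Finset.mem_insert_self i s)).add (ih fun j hj => h j (Finset.mem_insert_of_mem hj))

variable (A M) in
/-- The `M`-span of the operators `ι_M ∘ Δ_q`, `|q| ≤ n`, of a Hasse–Schmidt system: the operators
`t ↦ Σ_q Δ_q(t) · m_q`. [cite: EGAIV4, Thm. 16.11.2 (Hom_A(P^n, M) ≅ ⊕_{|q|≤n} M over étale coordinates)] -/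
def hasseSpanOver (Δ : (ι →₀ ℕ) → (A →ₗ[k] A)) (n : ℕ) : Submodule M (A →ₗ[k] M) :=
  Submodule.span M {E : A →ₗ[k] M | ∃ q : ι →₀ ℕ, q.degree ≤ n ∧ algebraLinearMap k A M ∘ₗ Δ q = E}

/-- Members of the span have order `≤ n`. [cite: EGAIV4, Thm. 16.11.2 (the D_q, |q| ≤ m, lie in Diff^m)] -/
theorem isDiffOpOver_of_mem_hasseSpanOver [DecidableEq ι] {Δ : (ι →₀ ℕ) → (A →ₗ[k] A)} {n : ℕ}
    (h0 : ∀ b, Δ 0 b = b)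
    (hmul : ∀ q : ι →₀ ℕ, q.degree ≤ n →
      ∀ f g : A, Δ q (f * g) = ∑ p ∈ Finset.antidiagonal q, Δ p.1 f * Δ p.2 g)
    {E : A →ₗ[k] M} (hE : E ∈ hasseSpanOver k A M Δ n) : IsDiffOpOver k n E := by
  refine Submodule.span_induction (p := fun E _ => IsDiffOpOver k n E) ?_ ?_ ?_ ?_ hE
  · rintro _ ⟨q, hq, rfl⟩
    exact ((isDiffOpLE_of_hasseSystem k h0 hmul q.degree q le_rfl hq).of_le hq).isDiffOpOver_comp
  · exact IsDiffOpOver.zero n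
  · intro _ _ _ _ h h'; exact h.add h'
  · intro c _ _ h; exact h.smul c

/-- **Degree peeling** (module targets): for `j ≤ n + 1` there is `E` in the `M`-span of the `ι_M ∘ Δ_q`,
`|q| ≤ n`, with `(T − E)(x^β) = 0` for all `|β| < j`. [cite: EGAIV4, Thm. 16.11.2 (proof: the coefficients a_q are forced by the values on the z^q)] -/
theorem exists_hasseSpanOver_sub_apply_coordMonomial_eq_zero [Fintype ι] [DecidableEq ι] {x : ι → A}
    {Δ : (ι →₀ ℕ) → (A →ₗ[k] A)} {n : ℕ}
    (hself : ∀ β : ι →₀ ℕ, β.degree ≤ n → Δ β (∏ i, x i ^ β i) = 1)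
    (hzero : ∀ q β : ι →₀ ℕ, q.degree ≤ n → ¬ q ≤ β → Δ q (∏ i, x i ^ β i) = 0)
    (T : A →ₗ[k] M) :
    ∀ j : ℕ, j ≤ n + 1 → ∃ E ∈ hasseSpanOver k A M Δ n,
      ∀ β : ι →₀ ℕ, β.degree < j → (T - E) (∏ i, x i ^ β i) = 0
  | 0, _ => ⟨0, Submodule.zero_mem _, fun β hβ => absurd hβ (Nat.not_lt_zero _)⟩
  | j + 1, hj => by
    obtain ⟨E, hE, hkill⟩ := exists_hasseSpanOver_sub_apply_coordMonomial_eq_zero hself hzero T j (by omega)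
    refine ⟨E + ∑ α ∈ (Finset.univ : Finset ι).finsuppAntidiag j,
        (T - E) (∏ i, x i ^ α i) • (algebraLinearMap k A M ∘ₗ Δ α), ?_, ?_⟩
    · refine Submodule.add_mem _ hE (Submodule.sum_mem _ fun α hα => Submodule.smul_mem _ _ ?_)
      exact Submodule.subset_span ⟨α, by rw [mem_finsuppAntidiag_univ_iff'.mp hα]; omega, rfl⟩
    · intro β hβ
      have hsplit : (T - (E + ∑ α ∈ (Finset.univ : Finset ι).finsuppAntidiag j,
            (T - E) (∏ i, x i ^ α i) • (algebraLinearMap k A M ∘ₗ Δ α))) (∏ i, x i ^ β i) =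
          (T - E) (∏ i, x i ^ β i) -
            ∑ α ∈ (Finset.univ : Finset ι).finsuppAntidiag j,
              (T - E) (∏ i, x i ^ α i) * algebraMap A M (Δ α (∏ i, x i ^ β i)) := by
        simp only [LinearMap.sub_apply, LinearMap.add_apply, LinearMap.sum_apply, LinearMap.smul_apply,
          LinearMap.comp_apply, smul_eq_mul]
        rw [sub_sub]
        rfl
      rw [hsplit, sub_eq_zero]
      rcases Nat.lt_succ_iff_lt_or_eq.mp hβ with hlt | heq
      · rw [hkill β hlt, eq_comm]
        refine Finset.sum_eq_zero fun α hα => ?_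
        rw [hzero α β (by rw [mem_finsuppAntidiag_univ_iff'.mp hα]; omega) ?_, map_zero, mul_zero]
        intro hle
        have := Finsupp.degree_mono hle
        rw [mem_finsuppAntidiag_univ_iff'.mp hα] at this
        omega
      · rw [Finset.sum_eq_single β]
        · rw [hself β (by omega), map_one, mul_one]
        · intro α hα hne
          rw [hzero α β (by rw [mem_finsuppAntidiag_univ_iff'.mp hα]; omega) ?_, map_zero, mul_zero]
          intro hle
          exact hne (eq_of_le_of_degree_eq' hle (by rw [mem_finsuppAntidiag_univ_iff'.mp hα, heq]))
        · intro hβ'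
          exact absurd (mem_finsuppAntidiag_univ_iff'.mpr heq) hβ'

/-- **EGA IV₄ 16.11.2 over a map, spanning half.** Under (UNR-M) and a truncated Hasse–Schmidt system of level `n`
along `x`, every operator `T : A → M` of order `≤ n` lies in the `M`-span of the `ι_M ∘ Δ_q`, `|q| ≤ n`:
`T = Σ_{|q|≤n} Δ_q(·) · m_q`. [cite: EGAIV4, Thm. 16.11.2 (Hom_A(P^n_{A/k}, M): P^n is free on the dz^q, |q| ≤ n)] -/
theorem mem_hasseSpanOver_of_isDiffOpOver [Fintype ι] [DecidableEq ι] {x : ι → A}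
    {Δ : (ι →₀ ℕ) → (A →ₗ[k] A)} {n : ℕ}
    (hunr : ∀ δ : Derivation k A M, (∀ i, δ (x i) = 0) → δ = 0)
    (h0 : ∀ b, Δ 0 b = b)
    (hmul : ∀ q : ι →₀ ℕ, q.degree ≤ n →
      ∀ f g : A, Δ q (f * g) = ∑ p ∈ Finset.antidiagonal q, Δ p.1 f * Δ p.2 g)
    (hself : ∀ β : ι →₀ ℕ, β.degree ≤ n → Δ β (∏ i, x i ^ β i) = 1)
    (hzero : ∀ q β : ι →₀ ℕ, q.degree ≤ n → ¬ q ≤ β → Δ q (∏ i, x i ^ β i) = 0)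
    {T : A →ₗ[k] M} (hT : IsDiffOpOver k n T) : T ∈ hasseSpanOver k A M Δ n := by
  obtain ⟨E, hE, hkill⟩ :=
    exists_hasseSpanOver_sub_apply_coordMonomial_eq_zero k hself hzero T (n + 1) le_rfl
  have hEord : IsDiffOpOver k n E := isDiffOpOver_of_mem_hasseSpanOver k h0 hmul hE
  have h0' : T - E = 0 :=
    eq_zero_of_isDiffOpOver_of_apply_coordMonomial_eq_zero k hunr n (hT.sub k hEord)
      fun β hβ => hkill β (Nat.lt_succ_of_le hβ)
  rw [sub_eq_zero] at h0'
  rw [h0']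
  exact hE

end OverSpan

/-! ### Lifting operators along a quotient map -/

section Lift

variable (k : Type*) {A : Type*} [CommRing k] [CommRing A] [Algebra k A] {ι : Type*} (𝒩 : Ideal A)

/-- **Lifting differential operators along a quotient.** Let `𝒩 ⊆ A` be an ideal and suppose `A` carries a
truncated Hasse–Schmidt system of level `n` along `x` with (UNR-M) for `M = A ⧸ 𝒩`. Then every operator
`T : A → A ⧸ 𝒩` over the quotient map of order `≤ n` is the reduction of a differential operator `D : A → A` of order
`≤ n`: `mk ∘ D = T` (lift the coefficients of `T = Σ_q Δ_q(·)·m_q`). [cite: EGAIV4, Thm. 16.11.2 (P^n_{A/k} free over étale coordinates, so Hom_A(P^n, A) → Hom_A(P^n, A/𝒩) is onto)] -/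
theorem exists_isDiffOpLE_comp_eq_of_isDiffOpOver [Fintype ι] [DecidableEq ι] {x : ι → A}
    {Δ : (ι →₀ ℕ) → (A →ₗ[k] A)} {n : ℕ}
    (hunr : ∀ δ : Derivation k A (A ⧸ 𝒩), (∀ i, δ (x i) = 0) → δ = 0)
    (h0 : ∀ b, Δ 0 b = b)
    (hmul : ∀ q : ι →₀ ℕ, q.degree ≤ n →
      ∀ f g : A, Δ q (f * g) = ∑ p ∈ Finset.antidiagonal q, Δ p.1 f * Δ p.2 g)
    (hself : ∀ β : ι →₀ ℕ, β.degree ≤ n → Δ β (∏ i, x i ^ β i) = 1)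
    (hzero : ∀ q β : ι →₀ ℕ, q.degree ≤ n → ¬ q ≤ β → Δ q (∏ i, x i ^ β i) = 0)
    {T : A →ₗ[k] A ⧸ 𝒩} (hT : IsDiffOpOver k n T) :
    ∃ D : A →ₗ[k] A, IsDiffOpLE k n D ∧ algebraLinearMap k A (A ⧸ 𝒩) ∘ₗ D = T := by
  have hmem := mem_hasseSpanOver_of_isDiffOpOver k hunr h0 hmul hself hzero hT
  refine Submodule.span_induction (p := fun T _ => ∃ D : A →ₗ[k] A, IsDiffOpLE k n D ∧
      algebraLinearMap k A (A ⧸ 𝒩) ∘ₗ D = T) ?_ ?_ ?_ ?_ hmem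
  · rintro _ ⟨q, hq, rfl⟩
    exact ⟨Δ q, (isDiffOpLE_of_hasseSystem k h0 hmul q.degree q le_rfl hq).of_le hq, rfl⟩
  · exact ⟨0, IsDiffOpLE.zero n, by rw [LinearMap.comp_zero]⟩
  · rintro _ _ _ _ ⟨D, hD, rfl⟩ ⟨D', hD', rfl⟩
    exact ⟨D + D', hD.add hD', by rw [LinearMap.comp_add]⟩
  · rintro c _ _ ⟨D, hD, rfl⟩
    obtain ⟨s, rfl⟩ := Ideal.Quotient.mk_surjective c
    refine ⟨s • D, hD.smul s, ?_⟩
    ext t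
    simp [Algebra.smul_def]

end Lift

end Literature.AlgebraicGeometry.Resolution
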